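import Summits.CriticalPhenomena.CardyFormulaZ2.Theorems.CardySelfDualSegmentUniformMarginalityDefs

/-!
# Stub (R) `stub_russoIdentity` of line `Sketch` for the crux `UniformMarginality`
(stmt-CriticalPhenomena-5472): the finite Margulis–Russo identity in the splitting bits,
`∂_t P_t(R,δ) = ½ Σ_{v ∈ K} E_t[(1 − 2 c_v) 𝟙{N_v pivotal}]` for `t ∈ (0,1)` and
`δ > 0`.

Proof: `K = (verts_finite R hδ).toFinset` (`not_isPivotal_northEdge`); `Pext_eq`,
`determinedBy_coinEvent` and an UNSIGNED Russo formula for `prodBernoulli` along a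
differentiable path of parameters (`hasDerivAt_prodBernoulli_real_sub`: the `e`-th term is
`p'_e · (P(insert e S ∈ A) − P(S \ {e} ∈ A))`), on the path
`b ↦ cornerParam (projIcc 0 1 b)` (coins: derivative `0`; splitting bits: `1/2` on `(0,1)`);
then `cornerPercolation = map cornerConfig`, `integral_map` and the pointwise identity
`russoIntegrand A v (cornerConfig S) = 𝟙_A(cornerConfig (insert (v,1) S)) −
𝟙_A(cornerConfig (S \ {(v,1)}))` (flipping the splitting bit of `v` flips exactly the north
edge of `v`, towards `open` iff the coin of `v` is `0`).
-/

noncomputable section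

namespace Summit.CriticalPhenomena.CardyFormulaZ2.Cruxes.UniformMarginality.HeatFlow

open MeasureTheory Literature.Probability.Percolation Literature.Probability.LatticeModels
  Literature.Probability.RandomPlanarGeometry
open scoped Classical

/-! ## §1 An unsigned Russo formula along a differentiable path of parameters -/

section Generic

variable {ι : Type*}

/-- Configurations agreeing on `K \ {e}` agree on `K` off `e`. -/
private theorem mem_iff_of_inter_erase_eq [DecidableEq ι] {K : Finset ι} {e : ι}
    {ω ω' : Set ι} (h : ω ∩ ↑(K.erase e) = ω' ∩ ↑(K.erase e)) :
    ∀ i ∈ K, i ≠ e → (i ∈ ω ↔ i ∈ ω') := by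
  intro i hiK hie
  have := Set.ext_iff.1 h i
  simp only [Set.mem_inter_iff, Finset.coe_erase, Set.mem_sdiff, Finset.mem_coe,
    Set.mem_singleton_iff] at this
  tauto

/-- If `A` is determined by `K`, the event `{S | insert e S ∈ A}` ("`A` holds once `e` is
switched on") is determined by `K \ {e}`. -/
private theorem determinedBy_insert_mem [DecidableEq ι] {A : Set (Set ι)} {K : Finset ι}
    (hA : DeterminedBy A (↑K : Set ι)) (e : ι) :
    DeterminedBy {S | insert e S ∈ A} (↑(K.erase e) : Set ι) := by
  rw [determinedBy_iff] at hA ⊢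
  intro ω ω' h
  have hi := mem_iff_of_inter_erase_eq h
  refine hA _ _ ?_
  ext i
  simp only [Set.mem_inter_iff, Set.mem_insert_iff, Finset.mem_coe]
  by_cases hie : i = e
  · simp [hie]
  · constructor
    · rintro ⟨hi', hiK⟩
      exact ⟨Or.inr ((hi i hiK hie).1 (hi'.resolve_left hie)), hiK⟩
    · rintro ⟨hi', hiK⟩
      exact ⟨Or.inr ((hi i hiK hie).2 (hi'.resolve_left hie)), hiK⟩

/-- If `A` is determined by `K`, the event `{S | S \ {e} ∈ A}` ("`A` holds once `e` is
switched off") is determined by `K \ {e}`. -/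
private theorem determinedBy_sdiff_mem [DecidableEq ι] {A : Set (Set ι)} {K : Finset ι}
    (hA : DeterminedBy A (↑K : Set ι)) (e : ι) :
    DeterminedBy {S | S \ {e} ∈ A} (↑(K.erase e) : Set ι) := by
  rw [determinedBy_iff] at hA ⊢
  intro ω ω' h
  have hi := mem_iff_of_inter_erase_eq h
  refine hA _ _ ?_
  ext i
  simp only [Set.mem_inter_iff, Set.mem_sdiff, Set.mem_singleton_iff, Finset.mem_coe]
  by_cases hie : i = e
  · simp [hie]
  · constructor
    · rintro ⟨⟨hi', -⟩, hiK⟩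
      exact ⟨⟨(hi i hiK hie).1 hi', hie⟩, hiK⟩
    · rintro ⟨⟨hi', -⟩, hiK⟩
      exact ⟨⟨(hi i hiK hie).2 hi', hie⟩, hiK⟩

/-- **Unsigned Russo formula along a differentiable path of parameters** (Russo 1981, §4,
Lemma 3, multi-parameter form, and the chain rule; no monotonicity of `A`): for an event `A`
determined by the finite set `K` and parameters `p b : ι → [0,1]` with `b ↦ p_e(b)`
differentiable at `β` with derivative `p'_e` (`e ∈ K`), `b ↦ P_{p(b)}(A)` has derivative
`Σ_{e ∈ K} p'_e · (P_{p(β)}(insert e S ∈ A) − P_{p(β)}(S \ {e} ∈ A))` at `β`. Mirror of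
`Literature.Probability.Percolation.hasDerivAt_prodBernoulli_real` (increasing `A`, bracket
`P(e pivotal)`); only the identification of the `e`-th term changes. -/
theorem hasDerivAt_prodBernoulli_real_sub [DecidableEq ι] (p : ℝ → ι → unitInterval)
    {A : Set (Set ι)} {K : Finset ι} (hK : DeterminedBy A (↑K : Set ι))
    (β : ℝ) (p' : ι → ℝ) (hp : ∀ e ∈ K, HasDerivAt (fun b => (p b e : ℝ)) (p' e) β) :
    HasDerivAt (fun b => (prodBernoulli (p b)).real A)
      (∑ e ∈ K, p' e * ((prodBernoulli (p β)).real {S | insert e S ∈ A} -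
        (prodBernoulli (p β)).real {S | S \ {e} ∈ A})) β := by
  classical
  set w : Finset ι → ι → ℝ → ℝ :=
    fun S i b => if i ∈ S then (p b i : ℝ) else 1 - (p b i : ℝ) with hw
  set dw : Finset ι → ι → ℝ := fun S i => if i ∈ S then p' i else -p' i with hdw
  have hwd : ∀ S, ∀ i ∈ K, HasDerivAt (w S i) (dw S i) β := by
    intro S i hi
    by_cases hiS : i ∈ S
    · have h1 : w S i = fun b => (p b i : ℝ) := by funext b; simp [hw, hiS]
      have h2 : dw S i = p' i := by simp [hdw, hiS]
      rw [h1, h2]; exact hp i hi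
    · have h1 : w S i = fun b => 1 - (p b i : ℝ) := by funext b; simp [hw, hiS]
      have h2 : dw S i = -p' i := by simp [hdw, hiS]
      rw [h1, h2]; exact (hp i hi).const_sub 1
  -- `P_{p(b)}(A)` is the cylinder polynomial
  have hrepr : (fun b => (prodBernoulli (p b)).real A) =
      fun b => ∑ S ∈ K.powerset, if (↑S : Set ι) ∈ A then ∏ i ∈ K, w S i b else 0 := by
    funext b
    rw [RussoPath.prodBernoulli_real_eq_sum_powerset hK (p b)]
  rw [hrepr]
  have hderiv : HasDerivAt
      (fun b => ∑ S ∈ K.powerset, if (↑S : Set ι) ∈ A then ∏ i ∈ K, w S i b else 0)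
      (∑ S ∈ K.powerset, if (↑S : Set ι) ∈ A then
        ∑ e ∈ K, (∏ j ∈ K.erase e, w S j β) * dw S e else 0) β := by
    refine HasDerivAt.fun_sum fun S _ => ?_
    split_ifs with hSA
    · simpa [smul_eq_mul] using HasDerivAt.fun_finsetProd (u := K) (x := β) (hwd S)
    · simpa using hasDerivAt_const β (0 : ℝ)
  -- exchange the sums and pair `S ↔ insert e S`
  convert hderiv using 1
  have hpush : (∑ S ∈ K.powerset, if (↑S : Set ι) ∈ A then
      ∑ e ∈ K, (∏ j ∈ K.erase e, w S j β) * dw S e else 0) =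
      ∑ S ∈ K.powerset, ∑ e ∈ K, (if (↑S : Set ι) ∈ A then
        (∏ j ∈ K.erase e, w S j β) * dw S e else 0) := by
    refine Finset.sum_congr rfl fun S _ => ?_
    split_ifs <;> simp
  rw [hpush, Finset.sum_comm]
  refine Finset.sum_congr rfl fun e he => ?_
  -- the `e`-th term: both events are cylinder events over `K \ {e}`
  have hins : (prodBernoulli (p β)).real {S | insert e S ∈ A} =
      ∑ S ∈ (K.erase e).powerset, if (↑S : Set ι) ∈ {S : Set ι | insert e S ∈ A} then
        ∏ i ∈ K.erase e, w S i β else 0 :=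
    RussoPath.prodBernoulli_real_eq_sum_powerset (determinedBy_insert_mem hK e) (p β)
  have hdel : (prodBernoulli (p β)).real {S | S \ {e} ∈ A} =
      ∑ S ∈ (K.erase e).powerset, if (↑S : Set ι) ∈ {S : Set ι | S \ {e} ∈ A} then
        ∏ i ∈ K.erase e, w S i β else 0 :=
    RussoPath.prodBernoulli_real_eq_sum_powerset (determinedBy_sdiff_mem hK e) (p β)
  rw [hins, hdel, ← Finset.sum_sub_distrib, Finset.mul_sum]
  have hpow : K.powerset = (K.erase e).powerset ∪ (K.erase e).powerset.image (insert e) := by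
    rw [← Finset.powerset_insert, Finset.insert_erase he]
  have hdisj : Disjoint (K.erase e).powerset ((K.erase e).powerset.image (insert e)) := by
    rw [Finset.disjoint_left]
    intro S hS hS'
    obtain ⟨T, -, rfl⟩ := Finset.mem_image.1 hS'
    have := Finset.mem_powerset.1 hS (Finset.mem_insert_self e T)
    simp at this
  have hinj : Set.InjOn (insert e) (↑(K.erase e).powerset : Set (Finset ι)) := by
    intro S hS T hT hST
    have heS : e ∉ S := fun h => by simpa using Finset.mem_powerset.1 hS h
    have heT : e ∉ T := fun h => by simpa using Finset.mem_powerset.1 hT h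
    rw [← Finset.erase_insert heS, ← Finset.erase_insert heT, hST]
  symm
  rw [hpow, Finset.sum_union hdisj, Finset.sum_image hinj, ← Finset.sum_add_distrib]
  refine Finset.sum_congr rfl fun S hS => ?_
  have heS : e ∉ S := fun h => by simpa using Finset.mem_powerset.1 hS h
  have heS' : e ∉ (↑S : Set ι) := by simpa using heS
  have hdS : dw S e = -p' e := by simp [hdw, heS]
  have hdiS : dw (insert e S) e = p' e := by simp [hdw]
  -- off `e` the weights of `S` and `insert e S` agree
  have hwi : ∏ j ∈ K.erase e, w (insert e S) j β = ∏ j ∈ K.erase e, w S j β := by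
    refine Finset.prod_congr rfl fun j hj => ?_
    have hje : j ≠ e := Finset.ne_of_mem_erase hj
    simp [hw, Finset.mem_insert, hje]
  rw [hdS, hdiS, hwi, Finset.coe_insert]
  simp only [Set.mem_setOf_eq, Set.sdiff_singleton_eq_self heS']
  split_ifs <;> ring

end Generic

/-! ## §2 Measurability and two set identities on configuration spaces `Set α` -/

section SetSpace

variable {α : Type*}

/-- Switching a coordinate on is measurable. -/
private theorem measurable_insert' (a : α) : Measurable (insert a : Set α → Set α) :=
  measurable_set_iff.2 fun x => by
    simp only [Set.mem_insert_iff]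
    exact measurable_const.or (measurable_set_mem x)

/-- Switching a coordinate off is measurable. -/
private theorem measurable_sdiff_singleton' (a : α) : Measurable (· \ {a} : Set α → Set α) :=
  measurable_set_iff.2 fun x => (measurable_set_mem x).and measurable_const

/-- The pivotality event of a measurable event is measurable. -/
private theorem measurableSet_isPivotal' {A : Set (Set α)} (hA : MeasurableSet A) (a : α) :
    MeasurableSet {S : Set α | IsPivotal A a S} := by
  have h1 : MeasurableSet {S : Set α | insert a S ∈ A} := measurable_insert' a hA
  have h2 : MeasurableSet {S : Set α | S \ {a} ∈ A} := measurable_sdiff_singleton' a hA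
  have h : {S : Set α | IsPivotal A a S} = ({S | insert a S ∈ A} ∩ {S | S \ {a} ∈ A}ᶜ) ∪
      ({S | S \ {a} ∈ A} ∩ {S | insert a S ∈ A}ᶜ) := by
    ext S
    simp only [IsPivotal, Xor, Set.mem_setOf_eq, Set.mem_union, Set.mem_inter_iff,
      Set.mem_compl_iff]
  rw [h]
  exact (h1.inter h2.compl).union (h2.inter h1.compl)

/-- A set containing `a` and agreeing with `ω` off `a` is `insert a ω`. -/
private theorem eq_insert_of_forall_ne {T ω : Set α} {a : α} (ha : a ∈ T)
    (h : ∀ x, x ≠ a → (x ∈ T ↔ x ∈ ω)) : T = insert a ω := by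
  ext x
  by_cases hx : x = a
  · subst hx; simp [ha]
  · simp [hx, h x hx]

/-- A set avoiding `a` and agreeing with `ω` off `a` is `ω \ {a}`. -/
private theorem eq_sdiff_of_forall_ne {T ω : Set α} {a : α} (ha : a ∉ T)
    (h : ∀ x, x ≠ a → (x ∈ T ↔ x ∈ ω)) : T = ω \ {a} := by
  ext x
  by_cases hx : x = a
  · subst hx; simp [ha]
  · simp [hx, h x hx]

end SetSpace

/-! ## §3 Flipping a splitting bit flips exactly the north edge -/

/-- Coin sets agreeing off the splitting bit `(v,1)` have corner configurations agreeing off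
the north edge of `v`. -/
private theorem mem_cornerConfig_congr_off {S S' : Set (Site 2 × Fin 2)} {v : Site 2}
    (h : ∀ i, i ≠ (v, (1 : Fin 2)) → (i ∈ S ↔ i ∈ S')) {e : Sym2 (Site 2)}
    (he : e ≠ northEdge v) : e ∈ cornerConfig S ↔ e ∈ cornerConfig S' := by
  simp only [mem_cornerConfig_iff]
  refine exists_congr fun w => ?_
  have h0 : (w, (0 : Fin 2)) ∈ S ↔ (w, (0 : Fin 2)) ∈ S' := h _ (by simp)
  by_cases hw : w = v
  · have hN : e ≠ s(w, w + ![0, 1]) := by rw [hw]; exact he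
    simp only [hN, false_and, or_false, h0]
  · have h1 : (w, (1 : Fin 2)) ∈ S ↔ (w, (1 : Fin 2)) ∈ S' := h _ (by simp [hw])
    rw [h0, h1]

/-- Coin `1`, splitting bit switched on: the north edge of `v` closes, nothing else moves. -/
private theorem cornerConfig_insert_of_mem {S : Set (Site 2 × Fin 2)} {v : Site 2}
    (hc : (v, (0 : Fin 2)) ∈ S) :
    cornerConfig (insert (v, (1 : Fin 2)) S) = cornerConfig S \ {northEdge v} := by
  refine eq_sdiff_of_forall_ne ?_ fun e he => mem_cornerConfig_congr_off (fun i hi => ?_) he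
  · rw [northEdge, north_mem_cornerConfig_iff]
    simp [hc]
  · simp [Set.mem_insert_iff, hi]

/-- Coin `1`, splitting bit switched off: the north edge of `v` opens, nothing else moves. -/
private theorem cornerConfig_sdiff_of_mem {S : Set (Site 2 × Fin 2)} {v : Site 2}
    (hc : (v, (0 : Fin 2)) ∈ S) :
    cornerConfig (S \ {(v, (1 : Fin 2))}) = insert (northEdge v) (cornerConfig S) := by
  refine eq_insert_of_forall_ne ?_ fun e he => mem_cornerConfig_congr_off (fun i hi => ?_) he
  · rw [northEdge, north_mem_cornerConfig_iff]
    simp [hc]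
  · simp [hi]

/-- Coin `0`, splitting bit switched on: the north edge of `v` opens, nothing else moves. -/
private theorem cornerConfig_insert_of_not_mem {S : Set (Site 2 × Fin 2)} {v : Site 2}
    (hc : (v, (0 : Fin 2)) ∉ S) :
    cornerConfig (insert (v, (1 : Fin 2)) S) = insert (northEdge v) (cornerConfig S) := by
  refine eq_insert_of_forall_ne ?_ fun e he => mem_cornerConfig_congr_off (fun i hi => ?_) he
  · rw [northEdge, north_mem_cornerConfig_iff]
    simp [hc]
  · simp [Set.mem_insert_iff, hi]

/-- Coin `0`, splitting bit switched off: the north edge of `v` closes, nothing else moves. -/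
private theorem cornerConfig_sdiff_of_not_mem {S : Set (Site 2 × Fin 2)} {v : Site 2}
    (hc : (v, (0 : Fin 2)) ∉ S) :
    cornerConfig (S \ {(v, (1 : Fin 2))}) = cornerConfig S \ {northEdge v} := by
  refine eq_sdiff_of_forall_ne ?_ fun e he => mem_cornerConfig_congr_off (fun i hi => ?_) he
  · rw [northEdge, north_mem_cornerConfig_iff]
    simp [hc]
  · simp [hi]

/-- **Pointwise Russo identity.** For an increasing event `A`, the Russo integrand at `v` on the
corner configuration of `S` is the difference of the indicators of `A` at the corner
configurations of `S` with the splitting bit of `v` switched on and off: flipping `d_v` flips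
exactly `N_v`, in the direction `closed → open` iff `c_v = 0`. -/
private theorem russoIntegrand_cornerConfig {A : Set (BondConfig (Site 2))}
    (hA : IsUpperSet A) (v : Site 2) (S : Set (Site 2 × Fin 2)) :
    russoIntegrand A v (cornerConfig S) =
      (insert (v, (1 : Fin 2)) ⁻¹' (cornerConfig ⁻¹' A)).indicator (fun _ => (1 : ℝ)) S -
        ((· \ {(v, (1 : Fin 2))}) ⁻¹' (cornerConfig ⁻¹' A)).indicator (fun _ => (1 : ℝ))
          S := by
  simp only [Set.indicator_apply, Set.mem_preimage]
  unfold russoIntegrand IsPivotal Xor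
  have hE : eastEdge v ∈ cornerConfig S ↔ (v, (0 : Fin 2)) ∈ S :=
    east_mem_cornerConfig_iff S v
  have hmono : cornerConfig S \ {northEdge v} ∈ A →
      insert (northEdge v) (cornerConfig S) ∈ A :=
    fun h => hA (Set.sdiff_subset.trans (Set.subset_insert _ _)) h
  by_cases hc : (v, (0 : Fin 2)) ∈ S
  · have hEv : eastEdge v ∈ cornerConfig S := hE.2 hc
    simp only [cornerConfig_insert_of_mem hc, cornerConfig_sdiff_of_mem hc, hEv, if_true]
    by_cases h1 : insert (northEdge v) (cornerConfig S) ∈ A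
    · by_cases h2 : cornerConfig S \ {northEdge v} ∈ A
      · simp [h1, h2]
      · simp [h1, h2]
    · have h2 : cornerConfig S \ {northEdge v} ∉ A := fun h => h1 (hmono h)
      simp [h1, h2]
  · have hEv : eastEdge v ∉ cornerConfig S := fun h => hc (hE.1 h)
    simp only [cornerConfig_insert_of_not_mem hc, cornerConfig_sdiff_of_not_mem hc, hEv,
      if_false]
    by_cases h1 : insert (northEdge v) (cornerConfig S) ∈ A
    · by_cases h2 : cornerConfig S \ {northEdge v} ∈ A
      · simp [h1, h2]
      · simp [h1, h2]
    · have h2 : cornerConfig S \ {northEdge v} ∉ A := fun h => h1 (hmono h)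
      simp [h1, h2]

/-! ## §4 The `v`-th Russo term as an expectation on bond configurations -/

/-- The Russo integrand is measurable. -/
private theorem measurable_russoIntegrand {A : Set (BondConfig (Site 2))} (hA : MeasurableSet A)
    (v : Site 2) : Measurable (russoIntegrand A v) := by
  unfold russoIntegrand
  refine Measurable.mul ?_ ?_
  · exact Measurable.ite (measurableSet_mem _) measurable_const measurable_const
  · exact Measurable.ite (measurableSet_isPivotal' hA _) measurable_const measurable_const

/-- For a measurable increasing event `A` and `μ = prodBernoulli P`, the `μ.map cornerConfig`-
expectation of `X_v` is
`μ(cornerConfig (insert (v,1) S) ∈ A) − μ(cornerConfig (S \ {(v,1)}) ∈ A)`. -/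
private theorem integral_russoIntegrand {A : Set (BondConfig (Site 2))} (hA : MeasurableSet A)
    (hA' : IsUpperSet A) (v : Site 2) (P : Site 2 × Fin 2 → unitInterval) :
    ∫ ω, russoIntegrand A v ω ∂((prodBernoulli P).map cornerConfig) =
      (prodBernoulli P).real (insert (v, (1 : Fin 2)) ⁻¹' (cornerConfig ⁻¹' A)) -
        (prodBernoulli P).real ((· \ {(v, (1 : Fin 2))}) ⁻¹' (cornerConfig ⁻¹' A)) := by
  have h1 := measurable_insert' (v, (1 : Fin 2)) (measurable_cornerConfig hA)
  have h2 := measurable_sdiff_singleton' (v, (1 : Fin 2)) (measurable_cornerConfig hA)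
  rw [integral_map measurable_cornerConfig.aemeasurable
    (measurable_russoIntegrand hA v).aestronglyMeasurable,
    show (fun S => russoIntegrand A v (cornerConfig S)) = fun S =>
      (insert (v, (1 : Fin 2)) ⁻¹' (cornerConfig ⁻¹' A)).indicator (fun _ => (1 : ℝ)) S -
        ((· \ {(v, (1 : Fin 2))}) ⁻¹' (cornerConfig ⁻¹' A)).indicator (fun _ => (1 : ℝ)) S
      from funext fun S => russoIntegrand_cornerConfig hA' v S,
    integral_sub ((integrable_const (1 : ℝ)).indicator h1)
      ((integrable_const (1 : ℝ)).indicator h2),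
    integral_indicator_const (1 : ℝ) h1, integral_indicator_const (1 : ℝ) h2, smul_eq_mul,
    mul_one, smul_eq_mul, mul_one]

/-! ## §5 The path of parameters -/

/-- The coin coordinate of the path is the constant `1/2`: derivative `0`. -/
private theorem hasDerivAt_coe_cornerParam_zero (v : Site 2) (t : ℝ) :
    HasDerivAt (fun b : ℝ =>
      ((cornerParam (Set.projIcc (0 : ℝ) 1 zero_le_one b) (v, 0) : unitInterval) : ℝ)) 0 t := by
  simp only [cornerParam_apply_zero, coe_half]
  exact hasDerivAt_const t _

/-- The splitting coordinate of the path is `b / 2` near `t ∈ (0,1)`: derivative `1/2`. -/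
private theorem hasDerivAt_coe_cornerParam_one (v : Site 2) {t : ℝ}
    (ht : t ∈ Set.Ioo (0 : ℝ) 1) :
    HasDerivAt (fun b : ℝ =>
      ((cornerParam (Set.projIcc (0 : ℝ) 1 zero_le_one b) (v, 1) : unitInterval) : ℝ))
      (1 / 2) t := by
  simp only [coe_cornerParam_apply_one]
  have h : HasDerivAt (fun b : ℝ => b / 2) (1 / 2) t := (hasDerivAt_id' t).div_const 2
  refine h.congr_of_eventuallyEq ?_
  filter_upwards [Ioo_mem_nhds ht.1 ht.2] with b hb
  rw [Set.projIcc_of_mem zero_le_one (Set.Ioo_subset_Icc_self hb)]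

/-! ## §6 The stub -/

/-- STUB (R) of line `Sketch`: **the Russo / heat-flow identity for the corner family**. For
`δ > 0`, with `K` the (finite) set of vertices whose mesh point lies in the carrier of `R`, no
north edge outside `K` is ever pivotal for the crude crossing event, and for every `t ∈ (0,1)`
`∂_t P_t(R,δ) = ½ Σ_{v ∈ K} E_t[(1 − 2 c_v) 𝟙{N_v pivotal}]`. -/
theorem stub_russoIdentity : RussoIdentity := by
  intro R δ hδ
  refine ⟨(verts_finite R hδ).toFinset, fun ω v hv => not_isPivotal_northEdge R hδ hv ω, ?_⟩
  intro t ht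
  set p : ℝ → Site 2 × Fin 2 → unitInterval :=
    fun b => cornerParam (Set.projIcc (0 : ℝ) 1 zero_le_one b) with hp
  set p' : Site 2 × Fin 2 → ℝ := fun i => if i.2 = 0 then 0 else 1 / 2 with hp'
  have hp'0 : ∀ v : Site 2, p' (v, 0) = 0 := fun v => by simp [hp']
  have hp'1 : ∀ v : Site 2, p' (v, 1) = 1 / 2 := fun v => by simp [hp']
  have hpd : ∀ i ∈ (verts_finite R hδ).toFinset ×ˢ (Finset.univ : Finset (Fin 2)),
      HasDerivAt (fun b => (p b i : ℝ)) (p' i) t := by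
    rintro ⟨v, j⟩ -
    by_cases hj : j = 0
    · subst hj; rw [hp'0]; exact hasDerivAt_coe_cornerParam_zero v t
    · obtain rfl : j = 1 := Fin.eq_one_of_ne_zero j hj
      rw [hp'1]; exact hasDerivAt_coe_cornerParam_one v ht
  have hmain := hasDerivAt_prodBernoulli_real_sub p (determinedBy_coinEvent R hδ) t p' hpd
  -- the derivative is the Russo sum
  have hsum : (∑ e ∈ (verts_finite R hδ).toFinset ×ˢ (Finset.univ : Finset (Fin 2)),
      p' e * ((prodBernoulli (p t)).real {S | insert e S ∈ coinEvent R δ} -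
        (prodBernoulli (p t)).real {S | S \ {e} ∈ coinEvent R δ})) =
      (1 / 2 : ℝ) * ∑ v ∈ (verts_finite R hδ).toFinset,
        ∫ ω, russoIntegrand (crossEvent R δ) v ω ∂(M t) := by
    rw [Finset.sum_product, Finset.mul_sum]
    refine Finset.sum_congr rfl fun v _ => ?_
    rw [Fin.sum_univ_two, hp'0, hp'1, zero_mul, zero_add]
    congr 1
    exact (integral_russoIntegrand (measurableSet_crossEvent R δ) (isUpperSet_crossEvent R δ)
      v _).symm
  rwa [hsum] at hmain

end Summit.CriticalPhenomena.CardyFormulaZ2.Cruxes.UniformMarginality.HeatFlow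

end
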